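/-
Width seat `ym-line-cbag-p1-w3` (prover-ym-line-cbag-p1-w3-g8-0; own items stmt-QuantumFields-22254 `BoxFloorAllGroups` /
stmt-QuantumFields-22893 `ExpChartPackage2` CLOSED proved), helping LINE 3 `route-QuantumFields-SixPlaneColdBox`
(cruxes stmt-QuantumFields-25708 `TorusMeanNearColdBoxG`, stmt-QuantumFields-25709 `DensityTransferG`): the numeric half of the
SHARP one-scale kernel-mean expansion with datum — the mean core's error sum is eventually `≤ β^{−1/4}` (not merely `≤ β^{−θ}`).
-/
import Summits.QuantumFields.YangMills.Theorems.ColdBoxAllGroupsBulkAllGroupsKernelDatumBoundsG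

/-!
# LINE 3 `SixPlaneColdBox`, glue «KernelMeanSharpG», part 1: the mean core's error sum is eventually `≤ β^{−1/4}`

The interface N2-mean-G `KernelMeanExpansionG ρ θ δ` of route `ColdBoxAllGroups` (and its proof `stub_kernelMeanExpansionG`) records the
one-scale expansion of deep kernel means with the precision `β^{−θ}` that crux `BulkAllGroups` needed.  Both cruxes of LINE 3
(`route-QuantumFields-SixPlaneColdBox`) need the SAME expansion to precision `o(β^{−4A})`, `A < θ` (crux `DensityTransferG`: «turning the mean
difference into `E|F̄|²` needs the mean's datum expansion two-sided to `o(β^{−1−4A})`»; crux `TorusMeanNearColdBoxG`, skeleton stub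
`stub_nestedBoxMeansAgreeG`: flat-box means to the same precision).  The engine already delivers it: with the PLAN-v6 parameters of
`eventually_kernelDatum_boundsG` (`δ = θ/5`, `ε = 6θ`, `r = Ca·β^{3θ+θ/5−1/2}`, `m = 2L`, `R = β^{6θ}/(4(√D+1))`) the four terms of
MEAN-RHS `= 2(2Nβ)pY + M(e^{2w}−1) + τ + 2(1+2D²(R'⁴+3))√P` are `≲ β·e^{−β^{6θ}}`, `β^{40θ−1/2} + β^{32θ−1}`, `β^{24θ−1/2}`,
`β^{14.8θ}e^{−bβ^{12θ}}` (p1's majorants `tiltD_majorant`, `cubicD_majorant`, `momentsD_majorant`, `badMassD_majorant`), hence each is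
eventually `≤ β^{−1/4}/4` for `0 < θ ≤ 1/200` (`40θ − 1/2 ≤ −3/10 < −1/4`).

* `eventually_meanD_T1_sharp` … `eventually_meanD_T4_sharp` — the four terms, each eventually `≤ β^{−1/4}/4`;
* **`eventually_kernelMean_boundsG_sharp`** — the MEAN clauses of `eventually_kernelDatum_boundsG` verbatim (`1 ≤ β`, `L ≤ η₀`, `m ≤ 1/4`,
  `m ≤ r₂`, `mE ≤ m`, `r ≤ m`, the sandwich window, `P ≤ 1/2`) with the sharp last clause MEAN-RHS `≤ β^{−(1/4)}`, in the spelling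
  `√(β·B)` of `kernelMeanG_sub_interface_le`.

Pure real analysis on top of p1's part 1–3 lemmas; no sorry; no definition; standard axioms.  NOT a claim about the Yang–Mills mass gap: glue
for a LINE onto the RECORD-type node `LatticeNonFreezing`; no summit statement is touched.
-/

set_option autoImplicit false

noncomputable section

open Filter Topology Finset Real

namespace Summit.QuantumFields.YangMills.Theorems.ColdBoxAllGroups

open Summit.QuantumFields.YangMills.Theorems.WeakCouplingRates
open Literature.MathematicalPhysics.QuantumFieldTheory.Balaban1983to89.B9Eq376POneLetters (exp_two_mul_sub_one_le_four_mul)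

variable {θ Ca CE C₂ : ℝ}

/-! ## The error terms of the mean core, eventually `≤ β^{−1/4}/4` each -/

/-- **M1 (sharp)**: `2(2Nβ)e^{−β^{6θ}} ≤ β^{−1/4}/4` eventually. -/
theorem eventually_meanD_T1_sharp (N : ℕ) (hθ : 0 < θ) :
    ∀ᶠ β : ℝ in atTop, 2 * (2 * (N : ℝ) * β) * Real.exp (-(β ^ (6 * θ))) ≤ β ^ (-(1 / 4 : ℝ)) / 4 := by
  refine eventually_le_rpow_div_of_le_rpow_mul_exp (C := 4 * (N : ℝ)) (s := 1) (a := 6 * θ) (b₀ := 1) (-(1 / 4 : ℝ))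
    (by positivity) one_pos (by norm_num) (fun β hβ => le_of_eq ?_)
  rw [one_mul, Real.rpow_one]; ring

/-- **M2 (sharp)**: `M(e^{2w}−1) ≤ β^{−1/4}/4` eventually (`0 < θ ≤ 1/200`: the binding exponent is `40θ − 1/2 ≤ −3/10`). -/
theorem eventually_meanD_T2_sharp (hθ : 0 < θ) (hθ2 : θ ≤ 1 / 200) (hCa : 0 ≤ Ca) (hC₂ : 0 ≤ C₂) :
    ∀ᶠ β : ℝ in atTop, β ^ (2 * (6 * θ)) * (Real.exp (2 * (120 * (2 * (⌈β ^ θ⌉₊ : ℝ) + 1) ^ 4 * (190 * β * (2 * ((12 * (⌈β ^ θ⌉₊ : ℝ) ^ 2 + 2 * ⌈β ^ θ⌉₊ + 1) * (Real.sqrt 2 * Real.sqrt (β ^ (2 * (6 * θ) - 1)) + 8 * (Ca * β ^ (3 * θ + θ / 5 - 1 / 2))))) ^ 3) + 4 * (2 * (⌈β ^ θ⌉₊ : ℝ) + 1) ^ 4 * (2 * C₂ * (2 * ((12 * (⌈β ^ θ⌉₊ : ℝ) ^ 2 + 2 * ⌈β ^ θ⌉₊ + 1) * (Real.sqrt 2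 * Real.sqrt (β ^ (2 * (6 * θ) - 1)) + 8 * (Ca * β ^ (3 * θ + θ / 5 - 1 / 2))))) ^ 2))) - 1) ≤ β ^ (-(1 / 4 : ℝ)) / 4 := by
  filter_upwards [eventually_tiltD_le_half hθ hθ2 hCa hC₂,
    eventually_le_rpow_div_of_le_rpow (f := fun β => 4 * (120 * 625 * 190 * (106 * (Real.sqrt 2 + 8 * Ca)) ^ 3) * β ^ (40 * θ - 1 / 2)) (b := -(1 / 4 : ℝ)) (s := 40 * θ - 1 / 2)
      (by linarith) (by norm_num : (0 : ℝ) < 8) (fun β _ => le_rfl),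
    eventually_le_rpow_div_of_le_rpow (f := fun β => 4 * (4 * 625 * (2 * C₂) * (106 * (Real.sqrt 2 + 8 * Ca)) ^ 2) * β ^ (32 * θ - 1)) (b := -(1 / 4 : ℝ)) (s := 32 * θ - 1)
      (by linarith) (by norm_num : (0 : ℝ) < 8) (fun β _ => le_rfl),
    eventually_ge_atTop (1 : ℝ)] with β hw h1 h2 hβ
  have hβ0 : 0 < β := by linarith
  have hr0 : 0 ≤ Ca * β ^ (3 * θ + θ / 5 - 1 / 2) := mul_nonneg hCa (Real.rpow_nonneg hβ0.le _)
  have hw0 : 0 ≤ (120 * (2 * (⌈β ^ θ⌉₊ : ℝ) + 1) ^ 4 * (190 * β * (2 * ((12 * (⌈β ^ θ⌉₊ : ℝ) ^ 2 + 2 * ⌈β ^ θ⌉₊ + 1) * (Real.sqrt 2 * Real.sqrt (β ^ (2 * (6 * θ) - 1)) + 8 * (Ca * β ^ (3 * θ + θ / 5 - 1 / 2))))) ^ 3) + 4 * (2 * (⌈β ^ θ⌉₊ : ℝ) + 1) ^ 4 * (2 * C₂ * (2 * ((12 * (⌈β ^ θ⌉₊ : ℝ) ^ 2 + 2 * ⌈β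 ^ θ⌉₊ + 1) * (Real.sqrt 2 * Real.sqrt (β ^ (2 * (6 * θ) - 1)) + 8 * (Ca * β ^ (3 * θ + θ / 5 - 1 / 2))))) ^ 2)) := by positivity
  have hexp := exp_two_mul_sub_one_le_four_mul hw0 hw
  have hW := tiltD_majorant hβ hθ.le hCa hC₂
  rw [rpow_two_mul_six]
  have e1 : β ^ (12 * θ) * β ^ (28 * θ - 1 / 2) = β ^ (40 * θ - 1 / 2) := by rw [← Real.rpow_add hβ0]; ring_nf
  have e2 : β ^ (12 * θ) * β ^ (20 * θ - 1) = β ^ (32 * θ - 1) := by rw [← Real.rpow_add hβ0]; ring_nf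
  have hM0 : 0 ≤ β ^ (12 * θ) := by positivity
  calc β ^ (12 * θ) * (Real.exp (2 * (120 * (2 * (⌈β ^ θ⌉₊ : ℝ) + 1) ^ 4 * (190 * β * (2 * ((12 * (⌈β ^ θ⌉₊ : ℝ) ^ 2 + 2 * ⌈β ^ θ⌉₊ + 1) * (Real.sqrt 2 * Real.sqrt (β ^ (2 * (6 * θ) - 1)) + 8 * (Ca * β ^ (3 * θ + θ / 5 - 1 / 2))))) ^ 3) + 4 * (2 * (⌈β ^ θ⌉₊ : ℝ) + 1) ^ 4 * (2 * C₂ * (2 * ((12 * (⌈β ^ θ⌉₊ : ℝ) ^ 2 + 2 * ⌈β ^ θ⌉₊ + 1) * (Real.sqrt 2 * Real.sqrt (β ^ (2 * (6 * θ) - 1)) + 8 * (Ca * β ^ (3 * θ + θ / 5 - 1 / 2))))) ^ 2))) - 1) ≤ β ^ (12 * θ) * (4 * (120 * (2 * (⌈β ^ θ⌉₊ : ℝ) + 1) ^ 4 * (190 * β * (2 * ((12 * (⌈β ^ θ⌉₊ : ℝ) ^ 2 + 2 * ⌈β ^ θ⌉₊ + 1) * (Real.sqrt 2 * Real.sqrt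 (β ^ (2 * (6 * θ) - 1)) + 8 * (Ca * β ^ (3 * θ + θ / 5 - 1 / 2))))) ^ 3) + 4 * (2 * (⌈β ^ θ⌉₊ : ℝ) + 1) ^ 4 * (2 * C₂ * (2 * ((12 * (⌈β ^ θ⌉₊ : ℝ) ^ 2 + 2 * ⌈β ^ θ⌉₊ + 1) * (Real.sqrt 2 * Real.sqrt (β ^ (2 * (6 * θ) - 1)) + 8 * (Ca * β ^ (3 * θ + θ / 5 - 1 / 2))))) ^ 2))) := mul_le_mul_of_nonneg_left hexp hM0
    _ ≤ β ^ (12 * θ) * (4 * ((120 * 625 * 190 * (106 * (Real.sqrt 2 + 8 * Ca)) ^ 3) * β ^ (28 * θ - 1 / 2) + (4 * 625 * (2 * C₂) * (106 * (Real.sqrt 2 + 8 * Ca)) ^ 2) * β ^ (20 * θ - 1))) := by gcongr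
    _ = 4 * (120 * 625 * 190 * (106 * (Real.sqrt 2 + 8 * Ca)) ^ 3) * (β ^ (12 * θ) * β ^ (28 * θ - 1 / 2)) + 4 * (4 * 625 * (2 * C₂) * (106 * (Real.sqrt 2 + 8 * Ca)) ^ 2) * (β ^ (12 * θ) * β ^ (20 * θ - 1)) := by ring
    _ = 4 * (120 * 625 * 190 * (106 * (Real.sqrt 2 + 8 * Ca)) ^ 3) * β ^ (40 * θ - 1 / 2) + 4 * (4 * 625 * (2 * C₂) * (106 * (Real.sqrt 2 + 8 * Ca)) ^ 2) * β ^ (32 * θ - 1) := by rw [e1, e2]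
    _ ≤ β ^ (-(1 / 4 : ℝ)) / 4 := by linarith

/-- **M3 (sharp)**: `τ ≤ β^{−1/4}/4` eventually (`24θ − 1/2 ≤ −19/50 < −1/4`). -/
theorem eventually_meanD_T3_sharp (hθ : 0 < θ) (hθ2 : θ ≤ 1 / 200) (hCa : 0 ≤ Ca) :
    ∀ᶠ β : ℝ in atTop, (190 * β * (2 * ((12 * (⌈β ^ θ⌉₊ : ℝ) ^ 2 + 2 * ⌈β ^ θ⌉₊ + 1) * (Real.sqrt 2 * Real.sqrt (β ^ (2 * (6 * θ) - 1)) + 8 * (Ca * β ^ (3 * θ + θ / 5 - 1 / 2))))) ^ 3) ≤ β ^ (-(1 / 4 : ℝ)) / 4 :=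
  eventually_le_rpow_div_of_le_rpow (C := 190 * (106 * (Real.sqrt 2 + 8 * Ca)) ^ 3) (s := 24 * θ - 1 / 2) (b := -(1 / 4 : ℝ)) (by linarith) (by norm_num)
    (fun β hβ => cubicD_majorant hβ hθ.le hCa)

/-- **M4 (sharp)**: `2(1+2D²(R'⁴+3))√P ≤ β^{−1/4}/4` eventually. -/
theorem eventually_meanD_T4_sharp (D : ℕ) (hθ : 0 < θ) (hCa : 0 ≤ Ca) :
    ∀ᶠ β : ℝ in atTop, 2 * (1 + 2 * (D : ℝ) ^ 2 * ((Real.sqrt (β * (CE * (2 * (⌈β ^ θ⌉₊ : ℝ) + 3) ^ 4 * β ^ (2 * (θ / 5) - 1))) + 4 * (Real.sqrt β * (Ca * β ^ (3 * θ + θ / 5 - 1 / 2)))) ^ 4 + 3)) * Real.sqrt (240 * (D : ℝ) * (2 * (⌈β ^ θ⌉₊ : ℝ) + 1) ^ 4 * Real.exp (-(β ^ (6 * θ) / (4 * (Real.sqrt D + 1))) ^ 2 / 2)) ≤ β ^ (-(1 / 4 : ℝ)) / 4 := by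
  have hb₀ : (0 : ℝ) < (1 / (64 * (Real.sqrt D + 1) ^ 2)) := by positivity
  refine eventually_le_rpow_div_of_le_rpow_mul_exp (C := (2 * (1 + 2 * (D : ℝ) ^ 2 * ((49 * Real.sqrt CE + 4 * Ca) ^ 4 + 3))) * Real.sqrt (150000 * (D : ℝ)))
    (s := 4 * (3 * θ + θ / 5) + 2 * θ) (a := 12 * θ) (b₀ := (1 / (64 * (Real.sqrt D + 1) ^ 2))) (-(1 / 4 : ℝ)) (by positivity) hb₀ (by norm_num) (fun β hβ => ?_)
  have hβ0 : 0 < β := by linarith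
  obtain ⟨-, hsP⟩ := badMassD_majorant D hβ hθ.le
  obtain ⟨-, -, -, hK4⟩ := momentsD_majorant (CE := CE) D hβ hθ.le hCa
  have hR'0 := backgroundD_nonneg hβ0.le hCa θ CE
  have h0 : 0 ≤ 2 * (1 + 2 * (D : ℝ) ^ 2 * ((Real.sqrt (β * (CE * (2 * (⌈β ^ θ⌉₊ : ℝ) + 3) ^ 4 * β ^ (2 * (θ / 5) - 1))) + 4 * (Real.sqrt β * (Ca * β ^ (3 * θ + θ / 5 - 1 / 2)))) ^ 4 + 3)) := by positivity
  have e : β ^ (4 * (3 * θ + θ / 5)) * β ^ (2 * θ) = β ^ (4 * (3 * θ + θ / 5) + 2 * θ) := by rw [← Real.rpow_add hβ0]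
  calc 2 * (1 + 2 * (D : ℝ) ^ 2 * ((Real.sqrt (β * (CE * (2 * (⌈β ^ θ⌉₊ : ℝ) + 3) ^ 4 * β ^ (2 * (θ / 5) - 1))) + 4 * (Real.sqrt β * (Ca * β ^ (3 * θ + θ / 5 - 1 / 2)))) ^ 4 + 3)) * Real.sqrt (240 * (D : ℝ) * (2 * (⌈β ^ θ⌉₊ : ℝ) + 1) ^ 4 * Real.exp (-(β ^ (6 * θ) / (4 * (Real.sqrt D + 1))) ^ 2 / 2))
      ≤ ((2 * (1 + 2 * (D : ℝ) ^ 2 * ((49 * Real.sqrt CE + 4 * Ca) ^ 4 + 3))) * β ^ (4 * (3 * θ + θ / 5))) * (Real.sqrt (150000 * (D : ℝ)) * β ^ (2 * θ) * Real.exp (-((1 / (64 * (Real.sqrt D + 1) ^ 2)) * β ^ (12 * θ)))) :=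
        mul_le_mul hK4 hsP (Real.sqrt_nonneg _) (by positivity)
    _ = (2 * (1 + 2 * (D : ℝ) ^ 2 * ((49 * Real.sqrt CE + 4 * Ca) ^ 4 + 3))) * Real.sqrt (150000 * (D : ℝ)) * (β ^ (4 * (3 * θ + θ / 5)) * β ^ (2 * θ)) * Real.exp (-((1 / (64 * (Real.sqrt D + 1) ^ 2)) * β ^ (12 * θ))) := by ring
    _ = _ := by rw [e]

/-! ## The deliverable: the mean clauses of `eventually_kernelDatum_boundsG` with the sharp error sum -/

set_option maxHeartbeats 800000 in
/-- **`eventually_kernelMean_boundsG_sharp`**: for `0 < θ ≤ 1/200` and all constants `N, D, Ca > 0, CE, r₂ > 0, C₂ ≥ 0, η₀ > 0`, eventually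
in `β`: `1 ≤ β`, the link window `L ≤ η₀`, `m = 2L ≤ 1/4`, `m ≤ r₂`, the sandwich radius `mE ≤ m`, `r ≤ m`, the cost window
`(D/2)(R+R')²/β + 190m³ < β^{2(6θ)−1}`, the Gaussian bad mass `P ≤ 1/2`, and the SHARP mean error sum
`2(2Nβ)pY + M(e^{2w}−1) + τ + 2(1+2D²(R'⁴+3))√P ≤ β^{−1/4}` (`pY = e^{−β^{6θ}}`, `M = β^{12θ}`; the scaled background spelled `√(β·B)` as in
`kernelMeanG_sub_interface_le`). -/
theorem eventually_kernelMean_boundsG_sharp (N D : ℕ) {Ca CE r₂ C₂ η₀ θ : ℝ} (hCa : 0 < Ca) (hr₂ : 0 < r₂) (hC₂ : 0 ≤ C₂)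
    (hη₀ : 0 < η₀) (hθ : 0 < θ) (hθ2 : θ ≤ 1 / 200) :
    ∀ᶠ β : ℝ in atTop, 1 ≤ β ∧
      ((12 * (⌈β ^ θ⌉₊ : ℝ) ^ 2 + 2 * (⌈β ^ θ⌉₊ : ℝ) + 1) * (Real.sqrt 2 * Real.sqrt (β ^ (2 * (6 * θ) - 1)) + 8 * (Ca * β ^ (3 * θ + θ / 5 - 1 / 2)))) ≤ η₀ ∧
      (2 * ((12 * (⌈β ^ θ⌉₊ : ℝ) ^ 2 + 2 * (⌈β ^ θ⌉₊ : ℝ) + 1) * (Real.sqrt 2 * Real.sqrt (β ^ (2 * (6 * θ) - 1)) + 8 * (Ca * β ^ (3 * θ + θ / 5 - 1 / 2))))) ≤ 1 / 4 ∧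
      (2 * ((12 * (⌈β ^ θ⌉₊ : ℝ) ^ 2 + 2 * (⌈β ^ θ⌉₊ : ℝ) + 1) * (Real.sqrt 2 * Real.sqrt (β ^ (2 * (6 * θ) - 1)) + 8 * (Ca * β ^ (3 * θ + θ / 5 - 1 / 2))))) ≤ r₂ ∧
      (Real.sqrt D * ((12 * (⌈β ^ θ⌉₊ : ℝ) ^ 2 + 2 * (⌈β ^ θ⌉₊ : ℝ) + 1) * (((β ^ (6 * θ) / (4 * (Real.sqrt D + 1))) + (Real.sqrt (β * (CE * (2 * (⌈β ^ θ⌉₊ : ℝ) + 3) ^ 4 * β ^ (2 * (θ / 5) - 1))) + 4 * (Real.sqrt β * (Ca * β ^ (3 * θ + θ / 5 - 1 / 2))))) + 4 * (Real.sqrt β * (Ca * β ^ (3 * θ + θ / 5 - 1 / 2))))) / Real.sqrt β) ≤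
        (2 * ((12 * (⌈β ^ θ⌉₊ : ℝ) ^ 2 + 2 * (⌈β ^ θ⌉₊ : ℝ) + 1) * (Real.sqrt 2 * Real.sqrt (β ^ (2 * (6 * θ) - 1)) + 8 * (Ca * β ^ (3 * θ + θ / 5 - 1 / 2))))) ∧
      Ca * β ^ (3 * θ + θ / 5 - 1 / 2) ≤
        (2 * ((12 * (⌈β ^ θ⌉₊ : ℝ) ^ 2 + 2 * (⌈β ^ θ⌉₊ : ℝ) + 1) * (Real.sqrt 2 * Real.sqrt (β ^ (2 * (6 * θ) - 1)) + 8 * (Ca * β ^ (3 * θ + θ / 5 - 1 / 2))))) ∧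
      (D : ℝ) / 2 * ((β ^ (6 * θ) / (4 * (Real.sqrt D + 1))) + (Real.sqrt (β * (CE * (2 * (⌈β ^ θ⌉₊ : ℝ) + 3) ^ 4 * β ^ (2 * (θ / 5) - 1))) + 4 * (Real.sqrt β * (Ca * β ^ (3 * θ + θ / 5 - 1 / 2))))) ^ 2 / β + 190 * (2 * ((12 * (⌈β ^ θ⌉₊ : ℝ) ^ 2 + 2 * (⌈β ^ θ⌉₊ : ℝ) + 1) * (Real.sqrt 2 * Real.sqrt (β ^ (2 * (6 * θ) - 1)) + 8 * (Ca * β ^ (3 * θ + θ / 5 - 1 / 2))))) ^ 3 < β ^ (2 * (6 * θ) - 1) ∧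
      (240 * (D : ℝ) * (2 * (⌈β ^ θ⌉₊ : ℝ) + 1) ^ 4 * Real.exp (-(β ^ (6 * θ) / (4 * (Real.sqrt D + 1))) ^ 2 / 2)) ≤ 1 / 2 ∧
      2 * (2 * N * β) * Real.exp (-(β ^ (6 * θ))) +
        (β ^ (2 * (6 * θ)) * (Real.exp (2 * (120 * (2 * (⌈β ^ θ⌉₊ : ℝ) + 1) ^ 4 * (190 * β * (2 * ((12 * (⌈β ^ θ⌉₊ : ℝ) ^ 2 + 2 * (⌈β ^ θ⌉₊ : ℝ) + 1) * (Real.sqrt 2 * Real.sqrt (β ^ (2 * (6 * θ) - 1)) + 8 * (Ca * β ^ (3 * θ + θ / 5 - 1 / 2))))) ^ 3) + 4 * (2 * (⌈β ^ θ⌉₊ : ℝ) + 1) ^ 4 * (2 * C₂ * (2 * ((12 * (⌈β ^ θ⌉₊ : ℝ) ^ 2 + 2 * (⌈β ^ θ⌉₊ : ℝ) + 1) * (Real.sqrt 2 * Real.sqrt (β ^ (2 * (6 * θ) - 1)) + 8 * (Ca * β ^ (3 * θ + θ / 5 - 1 / 2))))) ^ 2))) - 1) + (190 * β * (2 * ((12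 * (⌈β ^ θ⌉₊ : ℝ) ^ 2 + 2 * (⌈β ^ θ⌉₊ : ℝ) + 1) * (Real.sqrt 2 * Real.sqrt (β ^ (2 * (6 * θ) - 1)) + 8 * (Ca * β ^ (3 * θ + θ / 5 - 1 / 2))))) ^ 3) +
          2 * (1 + 2 * (D : ℝ) ^ 2 * ((Real.sqrt (β * (CE * (2 * (⌈β ^ θ⌉₊ : ℝ) + 3) ^ 4 * β ^ (2 * (θ / 5) - 1))) + 4 * (Real.sqrt β * (Ca * β ^ (3 * θ + θ / 5 - 1 / 2)))) ^ 4 + 3)) * Real.sqrt (240 * (D : ℝ) * (2 * (⌈β ^ θ⌉₊ : ℝ) + 1) ^ 4 * Real.exp (-(β ^ (6 * θ) / (4 * (Real.sqrt D + 1))) ^ 2 / 2))) ≤ β ^ (-(1 / 4 : ℝ)) := by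
  filter_upwards [eventually_ge_atTop (1 : ℝ), eventually_halfLinkD_le hθ hθ2 hCa.le hη₀,
    eventually_linkD_le hθ hθ2 hCa.le (by norm_num : (0 : ℝ) < 1 / 4), eventually_linkD_le hθ hθ2 hCa.le hr₂,
    eventually_windowD_aux (Ca := Ca) (CE := CE) D hθ hθ2, eventually_windowD_aux4 (Ca := Ca) hθ2, eventually_badMassD_le_half D hθ,
    eventually_meanD_T1_sharp N hθ, eventually_meanD_T2_sharp hθ hθ2 hCa.le hC₂, eventually_meanD_T3_sharp hθ hθ2 hCa.le,
    eventually_meanD_T4_sharp (CE := CE) D hθ hCa.le]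
    with β hβ hL hm4 hmr haux haux4 hP hm1 hm2 hm3 hmm4
  have hβ0 : 0 < β := by linarith
  obtain ⟨haux1, haux2, -⟩ := haux
  obtain ⟨hmEm, -, -⟩ := mED_majorant (CE := CE) D hβ hθ.le hCa.le haux1
  have hwin := windowD_m_of (CE := CE) D hβ hθ.le hCa.le haux2 haux4
  -- `r ≤ m = 2·(12H²+2H+1)(√2·√(β^{2ε−1}) + 8r)`
  have hX : 0 ≤ Ca * β ^ (3 * θ + θ / 5 - 1 / 2) := by positivity
  have hS : 0 ≤ Real.sqrt 2 * Real.sqrt (β ^ (2 * (6 * θ) - 1)) := by positivity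
  have hP1 : (1 : ℝ) ≤ 12 * (⌈β ^ θ⌉₊ : ℝ) ^ 2 + 2 * (⌈β ^ θ⌉₊ : ℝ) + 1 := by
    have : (0 : ℝ) ≤ (⌈β ^ θ⌉₊ : ℝ) := Nat.cast_nonneg _
    nlinarith
  have h1 : Real.sqrt 2 * Real.sqrt (β ^ (2 * (6 * θ) - 1)) + 8 * (Ca * β ^ (3 * θ + θ / 5 - 1 / 2)) ≤
      (12 * (⌈β ^ θ⌉₊ : ℝ) ^ 2 + 2 * (⌈β ^ θ⌉₊ : ℝ) + 1) *
        (Real.sqrt 2 * Real.sqrt (β ^ (2 * (6 * θ) - 1)) + 8 * (Ca * β ^ (3 * θ + θ / 5 - 1 / 2))) :=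
    le_mul_of_one_le_left (by positivity) hP1
  have hrm : Ca * β ^ (3 * θ + θ / 5 - 1 / 2) ≤
      2 * ((12 * (⌈β ^ θ⌉₊ : ℝ) ^ 2 + 2 * (⌈β ^ θ⌉₊ : ℝ) + 1) *
        (Real.sqrt 2 * Real.sqrt (β ^ (2 * (6 * θ) - 1)) + 8 * (Ca * β ^ (3 * θ + θ / 5 - 1 / 2)))) := by linarith
  exact ⟨hβ, hL, hm4, hmr, hmEm, hrm, hwin, hP, by linarith⟩

end Summit.QuantumFields.YangMills.Theorems.ColdBoxAllGroups

end
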